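import Literature.AlgebraicGeometry.Resolution.MarkedIdealsArithmetic
import Literature.AlgebraicGeometry.Resolution.RegularLocalOrder
import HarnessLib

/-!
# CouplingCutCoupled — §24–§25 of the decomp-res node «CouplingCut» (lens-4 g18; CRITIC-LEDGER row 117
CLEARED: DECIDED-MOD-PORT +1 cell
(L,P,¬pure,comm), located residual (L,P,drift,bi-wild,incomm)).

Content VERBATIM from the decomp-res lens-4 cumulative file `HOME/decomp-res-lens-4/g18/CouplingCut.lean` (sha256
5bf7b2ca8f7311e8;
its §1–§6 = g14 HugValuationCut, ALREADY in the tree as `Theorems/HugValuationCut{Chains,Classes,Kernels}` +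
`MaxContactCutHugValuationCut`; §7–§12 = g15 «MarkingBudget» @369c12ac; §13–§17 = g16 «WeightDescent»
@1cb1c32f; §18–§23 = g17
«FactorContact» @daf245ab; §24–§31 = g18 «CouplingCut»).  HOME = run/shared/lean/pub/decomp-res.

Route-independent, cone-free, scheme level (Literature-grade, any universe): §24 the COUPLED (lcm-balanced) SUM
`MarkedIdealCoupling.coupled`
of two marked ideals — `(𝓗^a + 𝓙^b, a·ν)` with balanced exponents `a·ν = b·μ` (Bierstone–Milman /
Włodarczyk / Kollár's sum of marked ideals
of different orders; NOT the tree's BGMW §3.7 (1) product-weight `MarkedIdeal.sum`) — support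
(`mem_support_coupled_iff`) and TRANSFORM
LAWS (`controlledTransform_coupled`, `transform_coupled`, `transform_coupled_of_isBlowup`), PROVED over the tree's
`Literature.AlgebraicGeometry.Resolution.MarkedIdealsArithmetic`; §25 the arithmetic of the coupled weight (PROVED):
`lcm ν μ < ν + μ ⟺ ν ∣ μ ∨ μ ∣ ν` (`lcm_lt_add_iff`) and the numerics of the incommensurable range
(`five_le_add_of_not_dvd`,
`five_mul_le_add_of_dvd_of_not_dvd`).
[WRITER NOTE (decomp-res writer g6): §24 generalised `Scheme.{0}` → `Scheme.{u}` (critic row 117); kept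
Summits-side next to the chain
(Literature holds only cited published statements); namespace `…Theorems.HugValuationCut.MarkedIdealCoupling`.]
(Sources: CossartJannsenSaito2020 Key Thm. 6.40, Cor. 6.37, Lem. 6.35/6.36; BierstoneGrigorievMilmanWlodarczyk2011
§3 (marked ideals, Lem. 3.2.1, §3.7); CossartPiltant2019; Abhyankar1956; Cutkosky2009 §2.1; Giraud1975
(Diff-lemma); EGAIV4 §16.8; BierstoneMilman1997; Wlodarczyk2005; Kollar2007 §3 (sums of marked ideals).)
-/

noncomputable section

open CategoryTheory AlgebraicGeometry IsLocalRing
open Literature.AlgebraicGeometry.Resolution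

namespace Summit.ResolutionOfSingularities.ResolutionOfSingularities.Theorems.HugValuationCut

universe u

/-! ## §24 (g18 · NEW) The COUPLED (lcm-balanced) SUM of two marked ideals — scheme level, PROVED (Literature-grade)

The tree's `MarkedIdeal.sum` is BGMW §3.7 (1): `(𝓗, ν) + (𝓙, μ) := (𝓗^μ + 𝓙^ν, ν·μ)` — weight the PRODUCT.  The
coupled sum below uses BALANCED exponents `a·ν = b·μ =: w` (best: `w = lcm(ν, μ)`, Bierstone–Milman /
Włodarczyk / Kollár's
convention): SAME support at regular points, SAME transforms, weight `lcm(ν, μ) ≤ ν·μ`.  For the two factors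
of a principal
hug (`ν + μ = n`) the coupled weight is `< n` exactly on the COMMENSURABLE range (§25) — the weight drop of
this generation. -/

namespace MarkedIdealCoupling

variable {X : Scheme.{u}}

/-- **THE COUPLED SUM `(𝓗, ν) ⊞_{a,b} (𝓙, μ) := (𝓗^a + 𝓙^b, a·ν)`** of two marked ideals (same boundary, taken from the
first), used with BALANCED exponents `a·ν = b·μ`. [folklore] -/
def coupled (M N : MarkedIdeal X) (a b : ℕ) : MarkedIdeal X :=
  ⟨M.ideal ^ a ⊔ N.ideal ^ b, M.boundary, a * M.mult⟩

/-- Unfolding `coupled`. [folklore] -/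
@[simp] theorem coupled_ideal (M N : MarkedIdeal X) (a b : ℕ) :
    (coupled M N a b).ideal = M.ideal ^ a ⊔ N.ideal ^ b := rfl
/-- Unfolding `coupled`. [folklore] -/
@[simp] theorem coupled_boundary (M N : MarkedIdeal X) (a b : ℕ) : (coupled M N a b).boundary = M.boundary := rfl
/-- Unfolding `coupled`. [folklore] -/
@[simp] theorem coupled_mult (M N : MarkedIdeal X) (a b : ℕ) : (coupled M N a b).mult = a * M.mult := rfl

/-- **SUPPORT, `⊇` at every point**: `supp(𝓗, ν) ∩ supp(𝓙, μ) ⊆ supp((𝓗, ν) ⊞ (𝓙, μ))` for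
balanced exponents
(`𝓗_x ⊆ 𝔪^ν ⇒ 𝓗_x^a ⊆ 𝔪^{aν}`). [folklore] -/
theorem support_inter_support_subset_support_coupled (M N : MarkedIdeal X) {a b : ℕ}
    (hbal : a * M.mult = b * N.mult) : M.support ∩ N.support ⊆ (coupled M N a b).support := by
  rintro x ⟨hM, hN⟩
  rw [MarkedIdeal.mem_support_iff] at hM hN ⊢
  rw [coupled_ideal, coupled_mult, stalkIdeal_sup, stalkIdeal_pow, stalkIdeal_pow]
  refine sup_le ?_ ?_
  · rw [mul_comm, pow_mul]
    exact Ideal.pow_right_mono hM _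
  · rw [hbal, mul_comm, pow_mul]
    exact Ideal.pow_right_mono hN _

/-- **SUPPORT LAW — `=` at a regular point** (`a, b ≥ 1`, balanced): `x ∈ supp((𝓗, ν) ⊞ (𝓙, μ)) ⟺
x ∈ supp(𝓗, ν) ∧
x ∈ supp(𝓙, μ)` — `𝓗_x^a ⊆ 𝔪^{aν} ⟺ 𝓗_x ⊆ 𝔪^ν` in a regular local ring (tree
`Ideal.pow_le_pow_mul_iff`: the order is a
valuation).  THE TOP LOCUS OF THE COUPLED MARKING OF A PRINCIPAL HUG IS `Top_j ∩ Tail_j`. [folklore] -/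
theorem mem_support_coupled_iff (M N : MarkedIdeal X) {x : X} [IsRegularLocalRing (X.presheaf.stalk x)] {a b : ℕ}
    (hbal : a * M.mult = b * N.mult) (ha : 0 < a) (hb : 0 < b) :
    x ∈ (coupled M N a b).support ↔ x ∈ M.support ∧ x ∈ N.support := by
  refine ⟨fun h => ?_, fun h => support_inter_support_subset_support_coupled M N hbal h⟩
  rw [MarkedIdeal.mem_support_iff, coupled_ideal, coupled_mult, stalkIdeal_sup, stalkIdeal_pow, stalkIdeal_pow,
    sup_le_iff] at h
  rw [MarkedIdeal.mem_support_iff, MarkedIdeal.mem_support_iff]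
  obtain ⟨h1, h2⟩ := h
  rw [hbal] at h2
  exact ⟨(Ideal.pow_le_pow_mul_iff ha).mp h1, (Ideal.pow_le_pow_mul_iff hb).mp h2⟩

variable {X' : Scheme.{u}} [IsLocallyNoetherian X'] {σ : X' ⟶ X} {C : X.IdealSheafData}

/-- **TRANSFORM LAW for the coupled IDEAL** (one blow-up `σ` with centre `C`, exceptional ideal effective Cartier, total
transforms divisible `σ^*𝓗 ⊆ 𝓘(D)^ν`, `σ^*𝓙 ⊆ 𝓘(D)^μ`, balanced `aν = bμ = w`):
`σᶜ(𝓗^a + 𝓙^b, w) = σᶜ(𝓗, ν)^a + σᶜ(𝓙, μ)^b` (tree `controlledTransform_sup`,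
`controlledTransform_pow`). [folklore] -/
theorem controlledTransform_coupled (hD : IsEffectiveCartier (C.comap σ)) {H J : X.IdealSheafData} {ν μ a b w : ℕ}
    (ha : a * ν = w) (hb : b * μ = w) (hH : H.comap σ ≤ C.comap σ ^ ν) (hJ : J.comap σ ≤ C.comap σ ^ μ) :
    controlledTransform σ C (H ^ a ⊔ J ^ b) w = controlledTransform σ C H ν ^ a ⊔ controlledTransform σ C J μ ^ b := by
  subst ha
  have hH' : (H ^ a).comap σ ≤ C.comap σ ^ (a * ν) := by
    rw [comap_pow, mul_comm, pow_mul]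
    exact pow_le_pow_left' hH _
  have hJ' : (J ^ b).comap σ ≤ C.comap σ ^ (a * ν) := by
    rw [comap_pow, ← hb, mul_comm, pow_mul]
    exact pow_le_pow_left' hJ _
  rw [controlledTransform_sup hD hH' hJ', controlledTransform_pow hD hH a]
  congr 1
  rw [← hb, controlledTransform_pow hD hJ b]

/-- **TRANSFORM LAW for the coupled MARKED IDEAL**: `[(𝓗, ν) ⊞ (𝓙, μ)]' = (𝓗, ν)' ⊞ (𝓙, μ)'`
under the divisibility
hypotheses — THE COUPLED MARKING OF A PRINCIPAL HUG TRANSFORMS INTO THE COUPLED MARKING OF THE TRANSFORMED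
FACTORS. [folklore] -/
theorem transform_coupled (hD : IsEffectiveCartier (C.comap σ)) (M N : MarkedIdeal X) {a b : ℕ}
    (hbal : a * M.mult = b * N.mult) (hM : M.ideal.comap σ ≤ C.comap σ ^ M.mult)
    (hN : N.ideal.comap σ ≤ C.comap σ ^ N.mult) :
    (coupled M N a b).transform σ C = coupled (M.transform σ C) (N.transform σ C) a b := by
  simp only [MarkedIdeal.transform, coupled, MarkedIdeal.mk.injEq, and_true]
  exact controlledTransform_coupled hD rfl hbal.symm hM hN

/-- For an admissible centre of both summands (inside both supports, snc with the common boundary) and a blow-up along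
it: `[(𝓗, ν) ⊞ (𝓙, μ)]' = (𝓗, ν)' ⊞ (𝓙, μ)'` (divisibility by BGMW Lemma 3.2.1, tree
`comap_ideal_le_pow`). [folklore] -/
theorem transform_coupled_of_isBlowup (M N : MarkedIdeal X) {a b : ℕ} (hbal : a * M.mult = b * N.mult)
    (hE : N.boundary = M.boundary) (hsuppM : (C.support : Set X) ⊆ M.support)
    (hsuppN : (C.support : Set X) ⊆ N.support) (hsnc : HasSNCWith M.boundary C) (hσ : IsBlowup σ C) :
    (coupled M N a b).transform σ C = coupled (M.transform σ C) (N.transform σ C) a b :=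
  transform_coupled hσ.isEffectiveCartier M N hbal (M.comap_ideal_le_pow hsuppM hsnc σ)
    (N.comap_ideal_le_pow hsuppN (hE ▸ hsnc) σ)

end MarkedIdealCoupling

/-! ## §25 (g18 · NEW) The arithmetic of the coupled weight (PROVED): `lcm(ν, μ) < ν + μ ⟺ ν ∣ μ ∨ μ ∣ ν` -/

/-- `ν ∣ μ ⇒ lcm(ν, μ) = μ` (the coupled weight of a commensurable pair is the LARGER order). [folklore] -/
theorem lcm_eq_of_dvd {ν μ : ℕ} (h : ν ∣ μ) : Nat.lcm ν μ = μ :=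
  Nat.dvd_antisymm (Nat.lcm_dvd h dvd_rfl) (Nat.dvd_lcm_right ν μ)

/-- **THE COMMENSURABILITY LAW**: for positive `ν, μ` the least common multiple is SMALLER THAN THE SUM exactly when one
of the two divides the other.  With `ν + μ = n` the weight of a tower and `ν, μ` the orders of the two factors of a
principal hug: THE COUPLED MARKING HAS WEIGHT `< n` EXACTLY ON THE COMMENSURABLE RANGE (and then weight `max(ν, μ)`);
on the incommensurable range every balanced coupling has weight `≥ lcm(ν, μ) ≥ n` — the induction on the weight has no
teeth there, which is why the incommensurable cell is the located residual and not an artefact of the method. [folklore] -/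
theorem lcm_lt_add_iff {ν μ : ℕ} (hν : 0 < ν) (hμ : 0 < μ) : Nat.lcm ν μ < ν + μ ↔ (ν ∣ μ ∨ μ ∣ ν) := by
  constructor
  · intro hlt
    by_contra hnd
    rw [not_or] at hnd
    obtain ⟨h1, h2⟩ := hnd
    set d := Nat.gcd ν μ with hd_def
    have hd : 0 < d := Nat.gcd_pos_of_pos_left μ hν
    obtain ⟨ν', hν'⟩ := Nat.gcd_dvd_left ν μ
    obtain ⟨μ', hμ'⟩ := Nat.gcd_dvd_right ν μ
    rw [← hd_def] at hν' hμ'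
    have key : d * Nat.lcm ν μ = ν * μ := Nat.gcd_mul_lcm ν μ
    have hl : Nat.lcm ν μ = d * ν' * μ' := by
      apply Nat.eq_of_mul_eq_mul_left hd
      rw [key, hν', hμ']
      ring
    have h2ν : 2 ≤ ν' := by
      rcases Nat.lt_or_ge ν' 2 with h | h
      · interval_cases ν'
        · omega
        · exact absurd (hν'.symm ▸ (mul_one d).symm ▸ (hμ' ▸ Dvd.intro μ' rfl : d ∣ μ)) h1
      · exact h
    have h2μ : 2 ≤ μ' := by
      rcases Nat.lt_or_ge μ' 2 with h | h
      · interval_cases μ'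
        · omega
        · exact absurd (hμ'.symm ▸ (mul_one d).symm ▸ (hν' ▸ Dvd.intro ν' rfl : d ∣ ν)) h2
      · exact h
    have hprod : ν' + μ' ≤ ν' * μ' := by nlinarith
    have : ν + μ ≤ Nat.lcm ν μ := by
      rw [hl, hν', hμ', ← mul_add, mul_assoc]
      exact Nat.mul_le_mul_left d hprod
    omega
  · rintro (h | h)
    · rw [lcm_eq_of_dvd h]; omega
    · rw [Nat.lcm_comm, lcm_eq_of_dvd h]; omega

/-- **INCOMMENSURABLE PAIRS ARE LARGE (PROVED)**: if neither of `ν, μ` divides the other then both are `≥ 2`, they are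
distinct, and `ν + μ ≥ 5`. [folklore] -/
theorem five_le_add_of_not_dvd {ν μ : ℕ} (h1 : ¬ ν ∣ μ) (h2 : ¬ μ ∣ ν) : 2 ≤ ν ∧ 2 ≤ μ ∧ ν ≠ μ ∧ 5 ≤ ν + μ := by
  have hν0 : ν ≠ 0 := by rintro rfl; exact h2 (dvd_zero μ)
  have hμ0 : μ ≠ 0 := by rintro rfl; exact h1 (dvd_zero ν)
  have hν1 : ν ≠ 1 := by rintro rfl; exact h1 (one_dvd μ)
  have hμ1 : μ ≠ 1 := by rintro rfl; exact h2 (one_dvd ν)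
  have hne : ν ≠ μ := by rintro rfl; exact h1 dvd_rfl
  omega

/-- **THE BI-WILD INCOMMENSURABLE BOUND (PROVED arithmetic)**: if a common `p` divides both orders (the bi-wild normal
form (N′) of g17 over a perfect field: `p ∣ ν`, `p ∣ n − ν`, port-level (R1)) and neither order divides
the other, then
`ν + μ ≥ 5p` — the located residual of this generation starts at weight `5p` (`p = 2`: `n ≥ 10`, `(ν, μ) =
(4, 6)`). [folklore] -/
theorem five_mul_le_add_of_dvd_of_not_dvd {p ν μ : ℕ} (hpν : p ∣ ν) (hpμ : p ∣ μ) (h1 : ¬ ν ∣ μ) (h2 : ¬ μ ∣ ν) :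
    5 * p ≤ ν + μ := by
  obtain ⟨ν', rfl⟩ := hpν
  obtain ⟨μ', rfl⟩ := hpμ
  have h1' : ¬ ν' ∣ μ' := fun h => h1 (mul_dvd_mul_left p h)
  have h2' : ¬ μ' ∣ ν' := fun h => h2 (mul_dvd_mul_left p h)
  have h5 := (five_le_add_of_not_dvd h1' h2').2.2.2
  rw [← mul_add, mul_comm 5 p]
  exact Nat.mul_le_mul_left p h5

end Summit.ResolutionOfSingularities.ResolutionOfSingularities.Theorems.HugValuationCut
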